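import Summits.NavierStokesRegularity.NavierStokesRegularity.Theses.AxisymmetricExtremality
import Summits.NavierStokesRegularity.NavierStokesRegularity.Theorems.AxisymmetricExtremalityAxisymmetricKatoGlobalStubSeregin2020TypeIINoSwirlEndgame
import Summits.NavierStokesRegularity.NavierStokesRegularity.Theorems.AxisymmetricExtremalityAxisymmetricKatoGlobalStubSeregin2020TypeIINoSwirlFirstSingular
import Summits.NavierStokesRegularity.NavierStokesRegularity.Theorems.AxisymmetricExtremalityAxisymmetricKatoGlobalStubSeregin2020TypeIINoSwirlSingularStructure
import HarnessLib

/-!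
# Seregin 2020, proof of Thm 2.1, the no-swirl endgame: reduction of the removal of the axis
# singularities to the regularity of ONE singular point with a clean parabolic past

Helper toward the stub `stub_seregin2020TypeII` of the crux `AxisymmetricKatoGlobal` (= the named
fact `Literature.Analysis.FluidPDE.Seregin2020_axisymmetricSingularPoint_typeII`, G. Seregin,
Anal. Math. Phys. 10 (2020) Paper 46 = arXiv:2006.04140, Thm 2.1), last paragraph of the
printed proof (arXiv p. 8): "`Γ = 0` and, therefore, `u_φ = 0` … any axially symmetric suitable
weak solution with no swirl … is smooth … (it can be done by considering a problem for
`η = ω_φ/ϱ` … reduction of it to spatial dimension 5 …). In particular, the function `u` is a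
continuous function in `Q̄(R)` for any `R > 0`. The latter contradicts restriction (2.9)".

The siblings prove: the swirl-free normal form `w'` of the blow-up limit keeps (𝒜), (2.9) and
the backward singular origin (`exists_ancientLimit_hasNoSwirl_repr`); the backward-singular set
`Σ(w') = {(t, x) | t ≤ 0, w' ∉ L_∞(Q((t,x), r)) ∀ r > 0}` is closed, on the axis and `𝒫¹`-null
(`ancientLimit_backwardSingular_structure`); such a set has, near each of its points, a point
with a clean parabolic past (`exists_clean_first_singular_point_of_isParabolicNull`). This file
assembles them into the REDUCTION of the whole endgame to its analytic core, the local
`η`-maximum-principle step at one clean configuration: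

* `not_isBackwardSingularPoint_of_forall_clean` — if no point `ẑ ∈ Σ(w)` admits a radius
  `R > 0` with `Σ(w) ∩ ([t̂ - R², t̂] × B̄(x̂, R)) ⊆ {t̂} × B(x̂, R)`, then the origin is not a
  backward singular point of `w` (any `(w, π)` suitable in every `Q(a)` with axisymmetric
  slices);
* `false_of_ae_swirl_eq_zero_of_forall_clean` — the endgame from the `Γ ≡ 0` step: (𝒜), (2.9),
  backward singular origin, `swirl = 0` a.e. on every `Q(a)`, and the core step for the
  swirl-free normal form, are contradictory.

The core step itself ("a swirl-free axisymmetric suitable weak solution which is regular in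
`[t̂ - R², t̂) × B̄(x̂, R)` and near the lateral boundary is bounded near `(t̂, x̂)`", by
`noSwirl_abs_scalar_le_of_boundary` and a vorticity-to-velocity bound) is not in the tree.

## References

* G. Seregin, Anal. Math. Phys. 10 (2020), Paper 46 = arXiv:2006.04140, proof of Thm. 2.1, last
  paragraph (arXiv p. 8). [Seregin2020]
-/

-- the problem directory repeats the summit name (D-0017); core's `dupNamespace` linter fires
set_option linter.dupNamespace false

noncomputable section

open MeasureTheory Set Function Filter Topology TopologicalSpace Metric
open scoped NNReal ENNReal

namespace Summit.NavierStokesRegularity.NavierStokesRegularity.Theorems.AxisymmetricKatoGlobal.EulerScaling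

open Literature.Analysis.FluidPDE Literature.Analysis.FluidPDE.Seregin2020

/-- **Reduction of the removal of axis singularities to one clean configuration.** Let `(w, π)`
be an Albritton–Barker suitable weak solution in every `Q(a)`, `a > 0`, with axisymmetric
slices, and `Σ = {z = (t, x) | t ≤ 0 ∧ ¬ ∃ r > 0, w ∈ L_∞(Q(z, r))}` its backward-singular set.
If every `ẑ ∈ Σ` and `R > 0` violate the clean-past property
"`z ∈ Σ`, `dist x x̂ ≤ R`, `t̂ - R² ≤ t ≤ t̂` force `t = t̂` and `dist x x̂ < R`" (i.e. the core
regularity step excludes clean configurations), then the origin is not a backward singular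
point: otherwise `(0, 0) ∈ Σ`, and `Σ` — closed, on the axis, `𝒫¹`-null
(`ancientLimit_backwardSingular_structure`) — would contain a clean configuration
(`exists_clean_first_singular_point_of_isParabolicNull`).
[cite: Seregin2020, proof of Thm 2.1, last paragraph] -/
theorem not_isBackwardSingularPoint_of_forall_clean :
    ∀ (w : ℝ → EuclideanSpace ℝ (Fin 3) → EuclideanSpace ℝ (Fin 3))
      (π : ℝ → EuclideanSpace ℝ (Fin 3) → ℝ), (∀ s, IsAxisymmetric (w s)) →
      (∀ a : ℝ, 0 < a → IsSuitableWeakSolutionInBall a 0 w π) →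
      (∀ zc ∈ {z : ℝ × EuclideanSpace ℝ (Fin 3) | z.1 ≤ 0 ∧
          ¬ ∃ r > 0, eLpNorm (uncurry w) ∞ (volume.restrict (parabolicCylinder r z)) < ∞},
        ∀ R : ℝ, 0 < R →
          ¬ ∀ z ∈ {z : ℝ × EuclideanSpace ℝ (Fin 3) | z.1 ≤ 0 ∧
              ¬ ∃ r > 0, eLpNorm (uncurry w) ∞ (volume.restrict (parabolicCylinder r z)) < ∞},
            dist z.2 zc.2 ≤ R → zc.1 - R ^ 2 ≤ z.1 → z.1 ≤ zc.1 →
              z.1 = zc.1 ∧ dist z.2 zc.2 < R) →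
      ¬ IsBackwardSingularPoint w 0 := by
  intro w π hax hball hcore hsing
  obtain ⟨hclosed, haxis, hnull⟩ := ancientLimit_backwardSingular_structure w π hax hball
  -- the origin belongs to `Σ`
  have h0 : (0 : ℝ × EuclideanSpace ℝ (Fin 3)) ∈ {z : ℝ × EuclideanSpace ℝ (Fin 3) | z.1 ≤ 0 ∧
      ¬ ∃ r > 0, eLpNorm (uncurry w) ∞ (volume.restrict (parabolicCylinder r z)) < ∞} := by
    refine ⟨le_rfl, ?_⟩
    rintro ⟨r, hr, hfin⟩
    rw [hsing r hr] at hfin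
    exact lt_irrefl _ hfin
  -- a clean configuration inside `Σ`
  obtain ⟨zc, hzc, R, hR, -, -, -, hclean⟩ :=
    exists_clean_first_singular_point_of_isParabolicNull _ hclosed haxis hnull _ h0 1 one_pos
  exact hcore zc hzc R hR hclean

/-- **Seregin 2020, proof of Thm 2.1, the endgame after `Γ ≡ 0`, reduced to its analytic core.**
Let `(w, π)` have the properties (𝒜)(i)–(iii), (2.9) as delivered by
`exists_ancientLimit_isAxisymmetric` (axisymmetric slices, backward singular origin, the
`∀ a > 0` block), let the swirl of `w` vanish a.e. on every `Q(a)` (the `Γ ≡ 0` step), and let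
`w' = (s, y) ↦ poloidalPart (w s) y` be its swirl-free normal form. If the core regularity step
holds for `w'` — no point of the backward-singular set `Σ(w')` has a clean parabolic past — then
we have a contradiction ("the latter contradicts restriction (2.9)").
[cite: Seregin2020, proof of Thm 2.1, last paragraph] -/
theorem false_of_ae_swirl_eq_zero_of_forall_clean :
    ∀ (u w : ℝ → EuclideanSpace ℝ (Fin 3) → EuclideanSpace ℝ (Fin 3))
      (p π : ℝ → EuclideanSpace ℝ (Fin 3) → ℝ) (K : ℝ≥0) (κ : ℝ) (lam : ℕ → ℝ),
      (∀ s, IsAxisymmetric (w s)) → IsBackwardSingularPoint w 0 →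
      (∀ a : ℝ, 0 < a →
        IsSuitableWeakSolutionInBall a 0 w π ∧
        MemLp (uncurry w) 3
          (volume.restrict (parabolicCylinder a (0 : ℝ × EuclideanSpace ℝ (Fin 3)))) ∧
        Tendsto (fun j => eLpNorm
            (uncurry ((lam j) • stPull ((lam j) ^ 2) (lam j) (0 : ℝ)
              (0 : EuclideanSpace ℝ (Fin 3)) u) - uncurry w) 3
            (volume.restrict (parabolicCylinder a (0 : ℝ × EuclideanSpace ℝ (Fin 3)))))
          atTop (𝓝 0) ∧
        (∀ g : ℝ × EuclideanSpace ℝ (Fin 3) → ℝ,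
          MemLp g 3 (volume.restrict (parabolicCylinder a (0 : ℝ × EuclideanSpace ℝ (Fin 3)))) →
          Tendsto (fun j => ∫ w' in parabolicCylinder a (0 : ℝ × EuclideanSpace ℝ (Fin 3)),
              ((lam j) ^ 2 • stPull ((lam j) ^ 2) (lam j) (0 : ℝ)
                (0 : EuclideanSpace ℝ (Fin 3)) p) w'.1 w'.2 * g w')
            atTop (𝓝 (∫ w' in parabolicCylinder a (0 : ℝ × EuclideanSpace ℝ (Fin 3)),
              π w'.1 w'.2 * g w'))) ∧
        cknAEss a (0 : ℝ × EuclideanSpace ℝ (Fin 3)) w ≤ K ∧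
        cknC a (0 : ℝ × EuclideanSpace ℝ (Fin 3)) w ≤ K ∧
        cknD a (0 : ℝ × EuclideanSpace ℝ (Fin 3)) π ≤ K ∧
        (∃ G' : ℝ → EuclideanSpace ℝ (Fin 3) →
            EuclideanSpace ℝ (Fin 3) →L[ℝ] EuclideanSpace ℝ (Fin 3),
          HasWeakSpatialGradientOn
              (parabolicCylinderOpens (2 * a) (0 : ℝ × EuclideanSpace ℝ (Fin 3))) w G' ∧
            cknAEss a (0 : ℝ × EuclideanSpace ℝ (Fin 3)) w +
              cknE a (0 : ℝ × EuclideanSpace ℝ (Fin 3)) G' ≤ K) ∧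
        ENNReal.ofReal κ ≤ cknC a (0 : ℝ × EuclideanSpace ℝ (Fin 3)) w) →
      (∀ a : ℝ, 0 < a →
        ∀ᵐ z ∂(volume.restrict (parabolicCylinder a (0 : ℝ × EuclideanSpace ℝ (Fin 3)))),
          swirl (w z.1) z.2 = 0) →
      (∀ zc ∈ {z : ℝ × EuclideanSpace ℝ (Fin 3) | z.1 ≤ 0 ∧
          ¬ ∃ r > 0, eLpNorm (uncurry fun s y => poloidalPart (w s) y) ∞
            (volume.restrict (parabolicCylinder r z)) < ∞},
        ∀ R : ℝ, 0 < R →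
          ¬ ∀ z ∈ {z : ℝ × EuclideanSpace ℝ (Fin 3) | z.1 ≤ 0 ∧
              ¬ ∃ r > 0, eLpNorm (uncurry fun s y => poloidalPart (w s) y) ∞
                (volume.restrict (parabolicCylinder r z)) < ∞},
            dist z.2 zc.2 ≤ R → zc.1 - R ^ 2 ≤ z.1 → z.1 ≤ zc.1 →
              z.1 = zc.1 ∧ dist z.2 zc.2 < R) →
      False := by
  intro u w p π K κ lam hax hsing hall hsw hcore
  obtain ⟨hax', -, hsing', hall'⟩ := ancientLimit_poloidalPart hax hsing hall hsw
  exact not_isBackwardSingularPoint_of_forall_clean _ π hax' (fun a ha => (hall' a ha).1) hcore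
    hsing'

end Summit.NavierStokesRegularity.NavierStokesRegularity.Theorems.AxisymmetricKatoGlobal.EulerScaling

end
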